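import Summits.Schanuel.Schanuel.Theorems.RootDecomp1EAnchorTowers

/-!
# RootDecomp1E — anchor calculus, part 3: the OFF-AXIS cell is EMPTY under S⁻ ∧ CF (support item `OffAxisClosure`, stmt-Schanuel-30101)

Port (census seat, prover role) of the KERNEL THEOREMS 1–3 of lens-2's node «AxisAnchor» / «AnchorTower»
(`HOME/decomp-schanuel-lens-2/g6/AnchorTower.lean`, critic CLEARED 2026-08-30T06:41:43Z and 07:30:30Z; route RootDecomp1E round 5 typed
rev 12–15, 07:21:04Z):
* `defect_core` — submodularity of the predimension against a reduced tower (`δ(U ∩ T) ≤ δ(U) + δ(T) − δ(U + T)`, `δ(T) ≤ 0` by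
  Chow's remark);
* `anchor_sharp` — under one-defect Schanuel `S⁻ = DefectOneSchanuel` (stmt-Schanuel-25020) the ANCHOR `span_ℚ z ∩ 𝕃` of a
  span-minimal failure is SCHANUEL-SHARP;
* `closedFormSchanuel_of` — `S⁻ ∧ CF ⟹` closed-form Schanuel (`CF = ClosedFormAtomSchanuel`, stmt-Schanuel-27517), and
  `glin_of_closedFormSchanuel` — the GENERALISED LIN THEOREM: a sharp closed-form tuple spans a non-zero algebraic number or a
  non-zero logarithm of one;
* `offAxisClosure_holds : OffAxisClosure` — hence a dark anchored span-minimal saturated failure lies on the Lindemann–Weierstrass axis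
  or on the Baker axis, never off-axis: the support item stmt-Schanuel-30101 (`DefectOneSchanuel → ClosedFormAtomSchanuel → OADK`).
This file defines nothing; 0 sorry; axioms standard.
-/

set_option linter.dupNamespace false

noncomputable section

namespace Summit.Schanuel.Schanuel.Theorems.RootDecomp1EAnchor

open Complex IntermediateField
open Literature.NumberTheory.Transcendental (exists_nsmul_mem_span_int mem_adjoin_of_mem_span_int
  trdeg_adjoin_le_of_le isAlgebraic_adjoin_over_algebraAdjoin)
open Summit.Schanuel.Schanuel.Theses.RootDecomp1E (DefectOneSchanuel ClosedFormAtomSchanuel OffAxisClosure)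

/-! ## KERNEL THEOREM 1 — DEFECT CORE: submodularity of the predimension against a reduced tower -/

set_option maxHeartbeats 800000 in
/-- **defect_core.**  Let `t` be a ℚ-independent reduced tower (length τ), `u : Fin m → ℂ` ℚ-independent,
`u₀ : Fin m₀ → ℂ` a basis of `span u ∩ span t`.  If every ℚ-independent family inside `span t + span u`
satisfies Schanuel up to defect `e` and `trdeg F_u + e ≤ m`, then `trdeg F_{u₀} ≤ m₀`.
(`δ(U ∩ T) ≤ δ(U) + δ(T) − δ(U + T)` with `δ(T) ≤ 0` by Chow's remark.) -/
theorem defect_core {τ : ℕ} {t : Fin τ → ℂ} (ht : IsTower τ t) (htli : LinearIndependent ℚ t)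
    {m : ℕ} {u : Fin m → ℂ} (hu : LinearIndependent ℚ u)
    {m₀ : ℕ} {u₀ : Fin m₀ → ℂ} (hu₀ : LinearIndependent ℚ u₀)
    (hu₀u : ∀ j, u₀ j ∈ Submodule.span ℚ (Set.range u)) (hu₀t : ∀ j, u₀ j ∈ Submodule.span ℚ (Set.range t))
    (hW : ∀ x ∈ Submodule.span ℚ (Set.range u), x ∈ Submodule.span ℚ (Set.range t) →
      x ∈ Submodule.span ℚ (Set.range u₀))
    (e : ℕ)
    (hlow : ∀ (k : ℕ) (v : Fin k → ℂ), LinearIndependent ℚ v →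
      (∀ i, v i ∈ Submodule.span ℚ (Set.range t) ⊔ Submodule.span ℚ (Set.range u)) →
      (k : Cardinal) ≤ Algebra.trdeg ℚ ↥(adjoin ℚ (Set.range v ∪ Set.range (cexp ∘ v))) + (e : Cardinal))
    (hup : Algebra.trdeg ℚ ↥(adjoin ℚ (Set.range u ∪ Set.range (cexp ∘ u))) + (e : Cardinal) ≤ (m : Cardinal)) :
    Algebra.trdeg ℚ ↥(adjoin ℚ (Set.range u₀ ∪ Set.range (cexp ∘ u₀))) ≤ (m₀ : Cardinal) := by
  classical
  -- (1) an integer rescaling u₁ of u₀ whose generators lie in F_t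
  choose N hN0 hN using fun j => exists_nsmul_mem_span_int t (hu₀t j)
  obtain ⟨u₁, hu₁⟩ : ∃ u₁ : Fin m₀ → ℂ, u₁ = fun j => (N j : ℚ) • u₀ j := ⟨_, rfl⟩
  have hu₁li : LinearIndependent ℚ u₁ := by
    have h := hu₀.units_smul fun j => Units.mk0 (N j : ℚ) (Nat.cast_ne_zero.mpr (hN0 j))
    rw [hu₁]
    convert h using 1
    funext j
    simp [Units.smul_def]
  have hle : adjoin ℚ (Set.range u₁ ∪ Set.range (cexp ∘ u₁)) ≤ adjoin ℚ (Set.range t ∪ Set.range (cexp ∘ t)) := by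
    rw [adjoin_le_iff]
    rintro x (⟨j, rfl⟩ | ⟨j, rfl⟩)
    · rw [hu₁]
      exact (mem_adjoin_of_mem_span_int t (hN j)).1
    · rw [Function.comp_apply, hu₁]
      exact (mem_adjoin_of_mem_span_int t (hN j)).2
  have hu₁u : ∀ j, u₁ j ∈ Submodule.span ℚ (Set.range u) := fun j => by
    rw [hu₁]
    exact Submodule.smul_mem _ _ (hu₀u j)
  have hu₁u₀ : ∀ j, u₁ j ∈ Submodule.span ℚ (Set.range u₀) := fun j => by
    rw [hu₁]
    exact Submodule.smul_mem _ _ (Submodule.subset_span ⟨j, rfl⟩)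
  have hu₀u₁ : ∀ j, u₀ j ∈ Submodule.span ℚ (Set.range u₁) := fun j => by
    have hNj : (N j : ℚ) ≠ 0 := Nat.cast_ne_zero.mpr (hN0 j)
    have : u₀ j = (N j : ℚ)⁻¹ • u₁ j := by
      rw [hu₁]
      simp only [smul_smul, inv_mul_cancel₀ hNj, one_smul]
    rw [this]
    exact Submodule.smul_mem _ _ (Submodule.subset_span ⟨j, rfl⟩)
  -- (2) the spaces T = span t, V = span u: T ⊓ V = span u₀, dim (T ⊔ V) = τ + m − m₀
  obtain ⟨T, hT_def⟩ : ∃ T : Submodule ℚ ℂ, T = Submodule.span ℚ (Set.range t) := ⟨_, rfl⟩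
  obtain ⟨V, hV_def⟩ : ∃ V : Submodule ℚ ℂ, V = Submodule.span ℚ (Set.range u) := ⟨_, rfl⟩
  have hTV : T ⊓ V = Submodule.span ℚ (Set.range u₀) := by
    apply le_antisymm
    · rintro x ⟨hxT, hxV⟩
      rw [hT_def] at hxT
      rw [hV_def] at hxV
      exact hW x hxV hxT
    · rw [Submodule.span_le]
      rintro _ ⟨j, rfl⟩
      exact ⟨hT_def ▸ hu₀t j, hV_def ▸ hu₀u j⟩
  haveI hTfd : FiniteDimensional ℚ T := by
    rw [hT_def]; exact FiniteDimensional.span_of_finite ℚ (Set.finite_range t)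
  haveI hVfd : FiniteDimensional ℚ V := by
    rw [hV_def]; exact FiniteDimensional.span_of_finite ℚ (Set.finite_range u)
  have hT : Module.finrank ℚ T = τ := by
    rw [hT_def]; simpa using finrank_span_eq_card htli
  have hV : Module.finrank ℚ V = m := by
    rw [hV_def]; simpa using finrank_span_eq_card hu
  have hI : Module.finrank ℚ ↥(T ⊓ V) = m₀ := by
    rw [hTV]
    simpa using finrank_span_eq_card hu₀
  have hdim := Submodule.finrank_sup_add_finrank_inf_eq T V
  rw [hT, hV, hI] at hdim
  have hUdim : Module.finrank ℚ ↥(T ⊔ V) = τ + m - m₀ := by omega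
  -- (3) a basis of T ⊔ V as a ℚ-independent family of complex numbers; the defect-e bound on it
  obtain ⟨b⟩ : Nonempty (Module.Basis (Fin (τ + m - m₀)) ℚ ↥(T ⊔ V)) :=
    ⟨Module.finBasisOfFinrankEq _ _ hUdim⟩
  obtain ⟨w, hw⟩ : ∃ w : Fin (τ + m - m₀) → ℂ, w = fun k => ((b k : ↥(T ⊔ V)) : ℂ) := ⟨_, rfl⟩
  have hwli : LinearIndependent ℚ w := by
    rw [hw]
    exact b.linearIndependent.map' (T ⊔ V).subtype (Submodule.ker_subtype _)
  have hwmem : ∀ k, w k ∈ Submodule.span ℚ (Set.range t) ⊔ Submodule.span ℚ (Set.range u) := fun k => by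
    rw [hw, ← hT_def, ← hV_def]
    exact (b k).2
  have hS := hlow (τ + m - m₀) w hwli hwmem
  -- (4) F_w is algebraic over ℚ(t, u, e^t, e^u)
  have hFt_le : adjoin ℚ (Set.range t ∪ Set.range (cexp ∘ t)) ≤ adjoin ℚ ((Set.range t ∪ Set.range (cexp ∘ t)) ∪ (Set.range u ∪ Set.range (cexp ∘ u))) := adjoin.mono ℚ _ _ Set.subset_union_left
  have hFu_le : adjoin ℚ (Set.range u ∪ Set.range (cexp ∘ u)) ≤ adjoin ℚ ((Set.range t ∪ Set.range (cexp ∘ t)) ∪ (Set.range u ∪ Set.range (cexp ∘ u))) := adjoin.mono ℚ _ _ Set.subset_union_right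
  have hgen_w : ∀ x ∈ Set.range w ∪ Set.range (cexp ∘ w), IsAlgebraic ↥(adjoin ℚ ((Set.range t ∪ Set.range (cexp ∘ t)) ∪ (Set.range u ∪ Set.range (cexp ∘ u)))) x := by
    rintro x (⟨k, rfl⟩ | ⟨k, rfl⟩)
    · obtain ⟨y, hy, y', hy', hyy⟩ := Submodule.mem_sup.mp (b k).2
      have hwk : w k = y + y' := by rw [hw]; exact hyy.symm
      rw [hwk]
      rw [hT_def] at hy
      rw [hV_def] at hy'
      exact isAlgebraic_of_mem_adjoin
        (add_mem (hFt_le (mem_adjoin_of_mem_span hy)) (hFu_le (mem_adjoin_of_mem_span hy')))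
    · obtain ⟨y, hy, y', hy', hyy⟩ := Submodule.mem_sup.mp (b k).2
      have hwk : cexp (w k) = cexp y * cexp y' := by
        rw [← Complex.exp_add, hyy, hw]
      rw [Function.comp_apply, hwk]
      rw [hT_def] at hy
      rw [hV_def] at hy'
      exact isAlgebraic_mul (isAlgebraic_of_le hFt_le (exp_isAlgebraic_of_mem_span hy))
        (isAlgebraic_of_le hFu_le (exp_isAlgebraic_of_mem_span hy'))
  have hw_le : Algebra.trdeg ℚ ↥(adjoin ℚ (Set.range w ∪ Set.range (cexp ∘ w))) ≤ Algebra.trdeg ℚ ↥(adjoin ℚ ((Set.range t ∪ Set.range (cexp ∘ t)) ∪ (Set.range u ∪ Set.range (cexp ∘ u)))) :=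
    trdeg_adjoin_le_of_isAlgebraic hgen_w
  -- (5) tower laws: trdeg ℚ(t,u,…) = trdeg F_t + trdeg_{F_t} F_t(u, e^u) ≤ τ + trdeg_{F_u₁} F_u₁(u, e^u);
  --     trdeg F_u₁ + trdeg_{F_u₁} F_u₁(u, e^u) = trdeg ℚ(u₁, u, e^u₁, e^u) ≤ trdeg F_u
  have hK_eq := trdeg_adjoin_union_le_sum (K := ℚ) (Set.range t ∪ Set.range (cexp ∘ t)) (Set.range u ∪ Set.range (cexp ∘ u))
  have hA : Algebra.trdeg ℚ ↥(adjoin ℚ (Set.range t ∪ Set.range (cexp ∘ t))) ≤ (τ : Cardinal) := ht.trdeg_le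
  have hB := trdeg_adjoin_le_of_le hle (Set.range u ∪ Set.range (cexp ∘ u))
  have hCD := trdeg_adjoin_sum_le_union (K := ℚ) (Set.range u₁ ∪ Set.range (cexp ∘ u₁)) (Set.range u ∪ Set.range (cexp ∘ u))
  have hCD_le : Algebra.trdeg ℚ ↥(adjoin ℚ ((Set.range u₁ ∪ Set.range (cexp ∘ u₁)) ∪ (Set.range u ∪ Set.range (cexp ∘ u)))) ≤ Algebra.trdeg ℚ ↥(adjoin ℚ (Set.range u ∪ Set.range (cexp ∘ u))) := by
    refine trdeg_adjoin_le_of_isAlgebraic ?_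
    rintro x (hx | hx)
    · exact gens_isAlgebraic_of_mem_span hu₁u x hx
    · exact isAlgebraic_of_mem_adjoin (subset_adjoin ℚ _ hx)
  -- (6) everything is finite: pass to natural numbers (compose with `trans`, never `rw`: the
  --     `Algebra ℚ ↥F` instance paths of the generic lemmas differ syntactically from the local ones)
  obtain ⟨s, hs, hsm⟩ := exists_nat_eq_of_le_natCast (le_self_add.trans hup)
  have hse : s + e ≤ m := by
    have h := (add_le_add hs.symm.le le_rfl).trans hup
    exact_mod_cast h
  have hCDs := (hCD.trans hCD_le).trans hs.le
  obtain ⟨c, hc, hcs⟩ := exists_nat_eq_of_le_natCast (le_self_add.trans hCDs)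
  obtain ⟨d, hd, hds⟩ := exists_nat_eq_of_le_natCast (le_add_self.trans hCDs)
  obtain ⟨a', ha', ha'τ⟩ := exists_nat_eq_of_le_natCast hA
  obtain ⟨b', hb', hb'd⟩ := exists_nat_eq_of_le_natCast (hB.trans hd.le)
  have h1 : ((τ + m - m₀ : ℕ) : Cardinal) ≤ (a' : Cardinal) + (b' : Cardinal) + (e : Cardinal) :=
    ((hS.trans (add_le_add hw_le le_rfl)).trans (add_le_add hK_eq le_rfl)).trans
      (add_le_add (add_le_add ha'.le hb'.le) le_rfl)
  have h1' : τ + m - m₀ ≤ a' + b' + e := by exact_mod_cast h1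
  have h2 : c + d ≤ s := by
    rw [hc, hd] at hCDs
    exact_mod_cast hCDs
  have hcm : c ≤ m₀ := by omega
  have hcm' : (c : Cardinal) ≤ (m₀ : Cardinal) := by exact_mod_cast hcm
  -- (7) conclusion: trdeg F_u₀ = trdeg F_u₁ = c ≤ m₀
  exact (trdeg_eq_of_span_eq hu₀u₁ hu₁u₀).le.trans (hc.le.trans hcm')

/-! ## KERNEL THEOREM 2 — under S⁻ the ANCHOR of a span-minimal failure is SCHANUEL-SHARP -/

/-- **anchor_sharp.**  Assume one-defect Schanuel `S⁻`.  Let `z` be a ℚ-independent SPAN-MINIMAL failure of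
Schanuel (`trdeg ℚ(z, e^z) < n`) and `ℓ : Fin a → ℂ` (`a < n`) a basis of its ANCHOR `span_ℚ z ∩ 𝕃`.  Then
`trdeg ℚ(ℓ, e^ℓ) = a` EXACTLY: the closed-form part of a shortest counterexample sits ON THE BOUNDARY of
Schanuel's inequality (defect_core with `e = 1`, plus span-minimality). -/
theorem anchor_sharp (hD : DefectOneSchanuel) {n : ℕ} {z : Fin n → ℂ} (hz : LinearIndependent ℚ z)
    (hmin : SpanMinimal n z)
    (hfail : Algebra.trdeg ℚ ↥(adjoin ℚ (Set.range z ∪ Set.range (cexp ∘ z))) < (n : Cardinal))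
    {a : ℕ} (ℓ : Fin a → ℂ) (hℓ : LinearIndependent ℚ ℓ) (ha : a < n)
    (hℓz : ∀ j, ℓ j ∈ Submodule.span ℚ (Set.range z)) (hℓL : ∀ j, ℓ j ∈ closedFormField)
    (hW : ∀ x ∈ Submodule.span ℚ (Set.range z), x ∈ closedFormField → x ∈ Submodule.span ℚ (Set.range ℓ)) :
    Algebra.trdeg ℚ ↥(adjoin ℚ (Set.range ℓ ∪ Set.range (cexp ∘ ℓ))) = (a : Cardinal) := by
  obtain ⟨τ, t, ht, htli, hℓt⟩ := exists_tower_of_closedForm ℓ hℓL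
  refine le_antisymm ?_ (hmin a ℓ ha hℓ hℓz)
  obtain ⟨s, hsn, hs⟩ := exists_nat_lt_of_lt_natCast hfail
  refine defect_core ht htli hz hℓ hℓz hℓt (fun x hx hxt => hW x hx (ht.span_le_closedFormField hxt)) 1
    (fun k v hv _ => by exact_mod_cast hD k v hv) ?_
  have h : (s : Cardinal) + ((1 : ℕ) : Cardinal) ≤ (n : Cardinal) := by exact_mod_cast hsn
  exact (add_le_add hs.le le_rfl).trans h

/-! ## CLOSED-FORM SCHANUEL from S⁻ ∧ CF, and the GENERALISED LIN THEOREM from closed-form Schanuel -/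

set_option maxHeartbeats 800000 in
/-- **glin_tower** — the induction behind `CFS ⟹ GLin`: inside the span of a ℚ-independent reduced tower,
every non-zero ℚ-independent family `u` with `trdeg F_u ≤ m` spans a non-zero algebraic number or logarithm
of one.  (Peel the top tower element `y`: if `span u ∩ span t ≠ 0` it is again sharp by `defect_core`
(`e = 0`) and we recurse; else `span u = ℚ·x` with `x = y + s`, `trdeg ℚ(x, e^x) ≤ 1`, and the tower condition
on `y` transported to `x` feeds the algebraic dichotomy.) -/
theorem glin_tower (hS : ClosedFormSchanuel) {τ : ℕ} {t : Fin τ → ℂ} (ht : IsTower τ t) :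
    LinearIndependent ℚ t → ∀ (m : ℕ) (u : Fin m → ℂ), 0 < m → LinearIndependent ℚ u →
      (∀ i, u i ∈ Submodule.span ℚ (Set.range t)) →
      Algebra.trdeg ℚ ↥(adjoin ℚ (Set.range u ∪ Set.range (cexp ∘ u))) ≤ (m : Cardinal) →
      ∃ x ∈ Submodule.span ℚ (Set.range u), x ≠ 0 ∧ (IsAlgebraic ℚ x ∨ IsAlgebraic ℚ (cexp x)) := by
  classical
  induction ht with
  | zero t =>
    intro _ m u hm hu hut _
    exfalso
    have h0 : u ⟨0, hm⟩ = 0 := by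
      have h := hut ⟨0, hm⟩
      have hr : Set.range t = ∅ := Set.range_eq_empty t
      rw [hr, Submodule.span_empty] at h
      exact (Submodule.mem_bot ℚ).mp h
    exact hu.ne_zero ⟨0, hm⟩ h0
  | @cons τ₀ t y ht hy ih =>
    intro hli m u hm hu hut hdeg
    obtain ⟨htli, hyt⟩ := linearIndependent_finCons.mp hli
    have hconsL : ∀ x ∈ Submodule.span ℚ (Set.range (Fin.cons y t : Fin (τ₀ + 1) → ℂ)),
        x ∈ closedFormField := fun x hx => (IsTower.cons t y ht hy).span_le_closedFormField hx
    have htsub : Submodule.span ℚ (Set.range t) ≤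
        Submodule.span ℚ (Set.range (Fin.cons y t : Fin (τ₀ + 1) → ℂ)) := by
      apply Submodule.span_mono
      rw [Fin.range_cons]
      exact Set.subset_insert _ _
    have husub : Submodule.span ℚ (Set.range u) ≤
        Submodule.span ℚ (Set.range (Fin.cons y t : Fin (τ₀ + 1) → ℂ)) := span_range_le hut
    by_cases hall : ∀ i, u i ∈ Submodule.span ℚ (Set.range t)
    · exact ih htli m u hm hu hall hdeg
    · obtain ⟨i₀, hi₀⟩ := not_forall.mp hall
      obtain ⟨m₀, u₀, hu₀, hu₀u, hu₀t, hW⟩ := exists_basis_span_inf u (Submodule.span ℚ (Set.range t))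
      rcases Nat.eq_zero_or_pos m₀ with hm₀ | hm₀
      · -- ONE-DIMENSIONAL CASE: span u ∩ span t = 0
        subst hm₀
        have hinf : ∀ x ∈ Submodule.span ℚ (Set.range u), x ∈ Submodule.span ℚ (Set.range t) → x = 0 := by
          intro x hx hxt
          have h := hW x hx hxt
          have hr : Set.range u₀ = ∅ := Set.range_eq_empty u₀
          rw [hr, Submodule.span_empty] at h
          exact (Submodule.mem_bot ℚ).mp h
        -- m = 1 by a dimension count
        haveI : FiniteDimensional ℚ ↥(Submodule.span ℚ (Set.range (Fin.cons y t : Fin (τ₀ + 1) → ℂ))) :=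
          FiniteDimensional.span_of_finite ℚ (Set.finite_range _)
        haveI : FiniteDimensional ℚ ↥(Submodule.span ℚ (Set.range u)) :=
          FiniteDimensional.span_of_finite ℚ (Set.finite_range _)
        haveI : FiniteDimensional ℚ ↥(Submodule.span ℚ (Set.range t)) :=
          FiniteDimensional.span_of_finite ℚ (Set.finite_range _)
        have hbot : Submodule.span ℚ (Set.range u) ⊓ Submodule.span ℚ (Set.range t) = ⊥ :=
          eq_bot_iff.mpr fun x hx => (Submodule.mem_bot ℚ).mpr (hinf x hx.1 hx.2)
        have hdim := Submodule.finrank_sup_add_finrank_inf_eq (Submodule.span ℚ (Set.range u))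
          (Submodule.span ℚ (Set.range t))
        rw [hbot, finrank_bot, add_zero] at hdim
        have hU : Module.finrank ℚ ↥(Submodule.span ℚ (Set.range u)) = m := by
          simpa using finrank_span_eq_card hu
        have hT : Module.finrank ℚ ↥(Submodule.span ℚ (Set.range t)) = τ₀ := by
          simpa using finrank_span_eq_card htli
        have hC : Module.finrank ℚ ↥(Submodule.span ℚ (Set.range (Fin.cons y t : Fin (τ₀ + 1) → ℂ))) =
            τ₀ + 1 := by
          simpa using finrank_span_eq_card hli
        have hle := Submodule.finrank_mono (sup_le husub htsub)
        rw [hdim, hU, hT, hC] at hle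
        have hm1 : m ≤ 1 := by omega
        -- the element x = y + s of span u
        have hx₀ := hut i₀
        rw [Fin.range_cons, Submodule.mem_span_insert] at hx₀
        obtain ⟨q, s, hs, hx₀eq⟩ := hx₀
        have hq : q ≠ 0 := by
          rintro rfl
          apply hi₀
          rw [hx₀eq, zero_smul, zero_add]
          exact hs
        obtain ⟨x, hxdef⟩ : ∃ x : ℂ, x = y + q⁻¹ • s := ⟨_, rfl⟩
        have hxu : x = q⁻¹ • u i₀ := by
          rw [hxdef, hx₀eq, smul_add, smul_smul, inv_mul_cancel₀ hq, one_smul]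
        have hx_span_u : x ∈ Submodule.span ℚ (Set.range u) := by
          rw [hxu]
          exact Submodule.smul_mem _ _ (Submodule.subset_span ⟨i₀, rfl⟩)
        have hs' : q⁻¹ • s ∈ Submodule.span ℚ (Set.range t) := Submodule.smul_mem _ _ hs
        have hx_not_t : x ∉ Submodule.span ℚ (Set.range t) := by
          intro h
          apply hyt
          have h2 := Submodule.sub_mem _ h hs'
          rw [hxdef, add_sub_cancel_right] at h2
          exact h2
        have hx0 : x ≠ 0 := by
          intro h
          apply hx_not_t
          rw [h]
          exact Submodule.zero_mem _
        have hxL : x ∈ closedFormField := hconsL x (husub hx_span_u)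
        -- trdeg ℚ(x, e^x) ≤ 1
        have hT1 : Algebra.trdeg ℚ ↥(adjoin ℚ (Set.range (fun _ : Fin 1 => x) ∪
            Set.range (cexp ∘ fun _ : Fin 1 => x))) ≤ ((1 : ℕ) : Cardinal) := by
          have h1 := trdeg_le_of_mem_span (z := u) (w := fun _ : Fin 1 => x) fun _ => hx_span_u
          have h2 : (m : Cardinal) ≤ ((1 : ℕ) : Cardinal) := by exact_mod_cast hm1
          exact h1.trans (hdeg.trans h2)
        -- not both of x, e^x are algebraic over F_t (closed-form Schanuel on the tower (x, t) + Chow)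
        have hnot : ¬ (IsAlgebraic ↥(adjoin ℚ (Set.range t ∪ Set.range (cexp ∘ t))) x ∧ IsAlgebraic ↥(adjoin ℚ (Set.range t ∪ Set.range (cexp ∘ t))) (cexp x)) := by
          rintro ⟨h1, h2⟩
          have hlix : LinearIndependent ℚ (Fin.cons x t : Fin (τ₀ + 1) → ℂ) :=
            linearIndependent_finCons.mpr ⟨htli, hx_not_t⟩
          have hLx : ∀ i, (Fin.cons x t : Fin (τ₀ + 1) → ℂ) i ∈ closedFormField := fun i => by
            refine Fin.cases ?_ (fun j => ?_) i
            · simpa using hxL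
            · simpa using ht.mem_closedFormField j
          have hlow := hS _ _ hlix hLx
          have hup := trdeg_adjoin_le_of_isAlgebraic (gens_cons_isAlgebraic _ t x le_rfl h1 h2)
          obtain ⟨a', ha', ha'τ⟩ := exists_nat_eq_of_le_natCast ht.trdeg_le
          have h := (hlow.trans hup).trans ha'.le
          have h' : τ₀ + 1 ≤ a' := by exact_mod_cast h
          omega
        -- the tower condition on y, transported to x = y + s'
        have hsF : q⁻¹ • s ∈ adjoin ℚ (Set.range t ∪ Set.range (cexp ∘ t)) := mem_adjoin_of_mem_span hs'
        have hstep : IsAlgebraic ↥(adjoin ℚ (Set.range t ∪ Set.range (cexp ∘ t))) x ∨ IsAlgebraic ↥(adjoin ℚ (Set.range t ∪ Set.range (cexp ∘ t))) (cexp x) := by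
          rcases hy with h | h
          · left
            rw [hxdef]
            exact isAlgebraic_add h (isAlgebraic_of_mem_adjoin hsF)
          · right
            rw [hxdef, Complex.exp_add]
            exact isAlgebraic_mul h (exp_isAlgebraic_of_mem_span hs')
        exact ⟨x, hx_span_u, hx0, algebraic_dichotomy _ x hT1 hnot hstep⟩
      · -- RECURSIVE CASE: span u ∩ span t ≠ 0 is again sharp (defect_core, e = 0) and lies in span t
        have hcore : Algebra.trdeg ℚ ↥(adjoin ℚ (Set.range u₀ ∪ Set.range (cexp ∘ u₀))) ≤ (m₀ : Cardinal) := by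
          refine defect_core ht htli hu hu₀ hu₀u hu₀t hW 0 ?_ ?_
          · intro k v hv hvmem
            have hvL : ∀ i, v i ∈ closedFormField := fun i =>
              hconsL _ ((sup_le htsub husub) (hvmem i))
            have h := hS k v hv hvL
            simpa using h
          · simpa using hdeg
        obtain ⟨x, hx, hx0, hax⟩ := ih htli m₀ u₀ hm₀ hu₀ hu₀t hcore
        exact ⟨x, span_range_le hu₀u hx, hx0, hax⟩

/-- **`CFS ⟹ GLin`** (tower lemma + `glin_tower`). -/
theorem glin_of_closedFormSchanuel (hS : ClosedFormSchanuel) : GLin := by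
  intro a ℓ ha hℓ hℓL hdeg
  obtain ⟨τ, t, ht, htli, hℓt⟩ := exists_tower_of_closedForm ℓ hℓL
  exact glin_tower hS ht htli a ℓ ha hℓ hℓt hdeg

/-! ## KERNEL THEOREM 3 — the OFF-AXIS cell is EMPTY under S⁻ ∧ CF -/

/-- **offAxis_of_defectOne_of_closedFormAtom: `S⁻ ∧ CF ⟹ OADK`.**  A span-minimal failure with non-zero anchor
has a SHARP anchor (anchor_sharp); by the generalised Lin theorem (from `CFS ⟸ S⁻ ∧ CF`) a sharp closed-form
tuple spans a non-zero algebraic number or logarithm of one — so the failure is on the Lindemann–Weierstrass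
axis or on the Baker axis, never off-axis. -/
theorem offAxis_of_defectOne_of_closedFormAtom (hD : DefectOneSchanuel) (hC : ClosedFormAtomSchanuel) :
    OffAxisAnchoredDarkAtomSchanuel := by
  have hG := glin_of_closedFormSchanuel (closedFormSchanuel_of hD hC)
  intro n z hz hdark hanch halgfree hlogfree hmin hsat
  by_contra hlt
  rw [not_le] at hlt
  obtain ⟨a, ℓ, hℓ, hℓz, hℓL, hW⟩ := exists_anchor_basis z
  have ha0 : 0 < a := by
    rcases Nat.eq_zero_or_pos a with h | h
    · exfalso
      subst h
      obtain ⟨x, hx, hx0, hxL⟩ := hanch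
      have h := hW x hx hxL
      have hr : Set.range ℓ = ∅ := Set.range_eq_empty ℓ
      rw [hr, Submodule.span_empty] at h
      exact hx0 ((Submodule.mem_bot ℚ).mp h)
    · exact h
  have han : a < n := anchor_rank_lt hz hdark ℓ hℓ hℓz hℓL
  have hsharp := anchor_sharp hD hz hmin hlt ℓ hℓ han hℓz hℓL hW
  obtain ⟨x, hx, hx0, hax⟩ := hG a ℓ ha0 hℓ hℓL hsharp.le
  have hxz : x ∈ Submodule.span ℚ (Set.range z) := span_range_le hℓz hx
  rcases hax with h | h
  · exact hx0 (halgfree x hxz h)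
  · exact hx0 (hlogfree x hxz h)

/-- **Item stmt-Schanuel-30101 (`OffAxisClosure`, support item of round 5 of route RootDecomp1E) HOLDS**:
`DefectOneSchanuel → ClosedFormAtomSchanuel → OffAxisAnchoredDarkAtomSchanuel`. -/
theorem offAxisClosure_holds : OffAxisClosure := offAxis_of_defectOne_of_closedFormAtom

end Summit.Schanuel.Schanuel.Theorems.RootDecomp1EAnchor
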